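import Summits.CriticalPhenomena.PercolationContinuityZ3.Theorems.Transplant.BSConj4BoxProdZ2OfSkeletonNode
import HarnessLib

/-!
# Per-graph form: `θ_{X □ ℤ²}((w,0), p_c) = 0` for ONE quasi-transitive `X` from the node and the tubes of THAT `X`

builds on p205010 (kernel theorem, internal audit signed; external expert review pending).
Status sentence (coordinator 2026-08-20T04:30Z): "θ(p_c) = 0 on ℤ^d, all d ≥ 2 — kernel-verified (Lean 4/Mathlib,
standard axioms); internal adversarial audit SIGNED 2026-08-20 04:29Z; external expert review pending."

Lane `prim-bschramm`, seat `prim-bschramm-lead`.  `bsConj4_boxProdZ2_of_skeletonNode` (p210253) takes tube-subcriticality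
for ALL `X` at once; instances (`X = Cay(H₃)`, `X = ℤ^a`, `X` a given lattice) want the per-graph form, which is the same
proof: growth dichotomy (exponential ⇒ Hutchcroft; subexponential ⇒ amenable product, Burton–Keane, product skeleton,
`continuity_of_skeleton_amenable`, root transport).  Conditional on the conjecture node `SamePWitnessOfSkeleton`
(NOT proved); nothing is claimed about the node. [cite: BenjaminiSchramm1996, Conj. 4] [cite: KozmaNitzan2024, §1 p. 2]
-/

noncomputable section

namespace Summit.CriticalPhenomena.PercolationContinuityZ3.Theorems.Transplant

open MeasureTheory Literature.Probability.Percolation Literature.Probability.LatticeModels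
open Literature.Barriers.CriticalPhenomena (IsQuasiTransitive IsGraphAmenable HasExponentialGrowth
  countable_of_connected_of_locallyFinite)

/-- **Per-graph reduction**: for a connected, locally finite, quasi-transitive `X` whose tubes
`X × {-ℓ,…,ℓ}²` are subcritical at `p_c(X □ ℤ²)`, the node `SamePWitnessOfSkeleton` gives `θ_{X □ ℤ²}((w,0), p_c) = 0` at
every root. [cite: BenjaminiSchramm1996, Conj. 4] [cite: Hutchcroft2016, Thm. 1] [cite: MartineauSevero2019, Cor. 2.2] -/
theorem theta_boxProdZ2_criticalProb_eq_zero_of_skeletonNode {W : Type} [DecidableEq W] (X : SimpleGraph W)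
    [X.LocallyFinite] (hc : X.Connected) (hq : IsQuasiTransitive X)
    (hT : ∀ w : W, BoxProdZ2.TubeSubcritical X (criticalProbIOf (X □ zdGraph 2) (w, (0 : Site 2))))
    (hW : SamePWitnessOfSkeleton) (w : W) :
    theta (X □ zdGraph 2) (w, (0 : Site 2)) (criticalProbIOf (X □ zdGraph 2) (w, (0 : Site 2))) = 0 := by
  by_cases hg : HasExponentialGrowth X
  · exact bsConj4_boxProdZ2_case_expGrowth X hc hq hg w
  · have hconn : (X □ zdGraph 2).Connected := connected_boxProd_zdGraph hc 2
    haveI : Countable (W × Site 2) := countable_of_connected_of_locallyFinite (X □ zdGraph 2) hconn (w, 0)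
    have ha : IsGraphAmenable (X □ zdGraph 2) := isGraphAmenable_boxProd_zdGraph X hq hg 2
    obtain ⟨t, ht, -, -, -⟩ := (boxProdZ2Skeleton X hq).frame (w, (0 : Site 2))
    obtain ⟨v₀, -, rfl⟩ := Finset.mem_image.1 ht
    have hC : (boxProdZ2Skeleton X hq).CylSubcritical (criticalProbIOf (X □ zdGraph 2) (v₀, (0 : Site 2))) := by
      intro t' ht' ℓ
      obtain ⟨v₁, -, rfl⟩ := Finset.mem_image.1 ht'
      rw [theta_induce_congr (X □ zdGraph 2) (cyl_boxProdZ2Skeleton X hq v₁ ℓ)]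
      exact hT v₀ ℓ v₁
    have h0 : theta (X □ zdGraph 2) (v₀, (0 : Site 2)) (criticalProbIOf (X □ zdGraph 2) (v₀, (0 : Site 2))) = 0 :=
      continuity_of_skeleton_amenable hW (X □ zdGraph 2) (boxProdZ2Skeleton X hq) hconn
        (isQuasiTransitive_boxProd_zdGraph hq 2) ha _ ht hC
    exact theta_criticalProbIOf_eq_zero_of_reachable (X □ zdGraph 2) (hconn.preconnected _ _) h0

end Summit.CriticalPhenomena.PercolationContinuityZ3.Theorems.Transplant

end
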